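import Mathlib
import HarnessLib
import HarnessLib.Audit
import Summits.ValiantsHypothesis.ValiantsHypothesis.Theorems.LacunarySymmetroidMatrixDescartesMiddleBinomial
import Summits.ValiantsHypothesis.ValiantsHypothesis.Theorems.LacunarySymmetroidMatrixDescartesDipWindow

/-!
# ValiantsHypothesis / LacunarySymmetroid — crux `MatrixDescartes` (stmt-ValiantsHypothesis-18050, V1), LINE (A) «product_plus_one»:
# the CONSTANT-FREE-ROW cell `ConstantFreeRowAtMostOne` (pen val-idea-25 g9 NOTE §56.13 (2); Sketch-T3-s59 rev 11, typed there, «EXACT, proved on paper»)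

One W row `g = −α + κX^a + γX^c` (`α, γ > 0 ≤ κ`), one CONSTANT-FREE zero-change row `q₀X^a + s₀X^c` (`q₀, s₀ ≥ 0`, `q₀ + s₀ > 0`)
and ANY `k` further zero-change rows `p_i + q_iX^a + s_iX^c` (`p_i > 0`, `q_i, s_i ≥ 0`), with support ratio `c ≤ (3 + 2√2)·a`, have
AT MOST ONE positive critical point — `constantFreeRowAtMostOne` below is the pen's typed statement VERBATIM.  (A company of the floor
`OneChangeFloorK3` at the bottom coupling: one `(+,−,−)`-type row up to sign, one-signed rows, one of them without bottom letter; the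
ratio window reaches beyond the tame threshold `4`.)

PROOF (the pen's multiplier quotient with Bhatia–Davis, in the derivative-light form of ✓ `…TopBinomial`).  `θ = t·d/dt`, block
`B = P₀·∏P_i`, row rates `ψ_i = θP_i/P_i` (a mean of the exponents `{0,a,c}`, resp. `{a,c}` for the constant-free row, under the row's
Gibbs weights), row variances `W_i = θψ_i`, `ψ_B = Σψ_i`, `V = ΣW_i`, `G = θg > 0`, `G₂ = θG`:
* `t·Φ′ = B·(G + g·ψ_B)`, so critical points are zeros of `F̂ := (1 + g·ψ_B/G)/B` and have `g < 0`;
* `F̂′ = (g·ψ_B/(t·B·G))·J`, `J = V/ψ_B − ψ_B − G₂/G` (`field_simp; ring`);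
* `J < 0` on `(0,∞)`: Bhatia–Davis row by row (`W_i + ψ_i² ≤ c·ψ_i`, and `W₀ + ψ₀² = (a+c)ψ₀ − ac` for the two-rate row, `ψ₀ ≥ a`)
  gives `V ≤ c·ψ_B − ac`; `G₂/G > a`; and `ψ_B² − (c−a)ψ_B + ac ≥ 0` because `(c−a)² ≤ 4ac`, which is `c ≤ (3+2√2)a`;
* Rolle: two critical points would force a zero of `F̂′`, i.e. of `J`, between them.

HONEST FRAMING: exact free-standing helper (one more cell of the «one W row × zero-change block» family); NOT T3♯ / T3♮ / Theorem D / the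
floor law; no stub of LINE (A) is touched (A40 unchanged, sorries 4 → 4); `OneChangeFloorK3`, `MatrixDescartes` OPEN; `VP ≠ VNP` is NOT proved
and nothing here bears on it.  No definitions, no named facts, no sorry.
-/

set_option linter.dupNamespace false

namespace Summit.ValiantsHypothesis.ValiantsHypothesis.Theorems.LacunarySymmetroidMatrixDescartes

namespace ZeroChange

open Polynomial Finset Set

/-- `c ≤ (3 + 2√2)·a` and `a ≤ c` give the discriminant inequality `(c − a)² ≤ 4ac`. -/
theorem sq_sub_le_four_mul {a c : ℝ} (ha : 0 ≤ a) (hac : a ≤ c) (h : c ≤ (3 + 2 * Real.sqrt 2) * a) :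
    (c - a) ^ 2 ≤ 4 * (a * c) := by
  have hr0 : 0 ≤ Real.sqrt 2 := Real.sqrt_nonneg _
  have hr2 : Real.sqrt 2 ^ 2 = 2 := Real.sq_sqrt (by norm_num)
  rcases le_or_gt (3 * a) c with h3 | h3
  · have h1 : 0 ≤ c - 3 * a := by linarith
    have h2 : c - 3 * a ≤ 2 * Real.sqrt 2 * a := by linarith
    have h4 : (c - 3 * a) ^ 2 ≤ (2 * Real.sqrt 2 * a) ^ 2 := pow_le_pow_left₀ h1 h2 2
    nlinarith
  · nlinarith

/-- **CONSTANT-FREE-ROW CELL (NOTE §56.13 (2)) — the pen g9 Sketch-T3-s59 `ConstantFreeRowAtMostOne`, VERBATIM**: a block containing a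
constant-free zero-change row `q₀X^a + s₀X^c`, with `c ≤ (3 + 2√2)·a`, gives one W row at most ONE positive critical point. -/
theorem constantFreeRowAtMostOne : ∀ (k a c : ℕ), 0 < a → a < c → ((c : ℝ) ≤ (3 + 2 * Real.sqrt 2) * a) →
    ∀ (α κ γ q₀ s₀ : ℝ) (p q s : Fin k → ℝ),
    0 < α → 0 ≤ κ → 0 < γ → 0 ≤ q₀ → 0 ≤ s₀ → 0 < q₀ + s₀ → (∀ i, 0 < p i ∧ 0 ≤ q i ∧ 0 ≤ s i) →
    posCrit (row a c (-α) κ γ * row a c 0 q₀ s₀ * ∏ i, row a c (p i) (q i) (s i)) ≤ 1 := by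
  intro k a c ha hac hratio α κ γ q₀ s₀ p q s hα hκ hγ hq₀ hs₀ hqs h
  classical
  have hc : 0 < c := ha.trans hac
  have ha' : (0 : ℝ) < a := by exact_mod_cast ha
  have hc' : (0 : ℝ) < c := by exact_mod_cast hc
  have hac' : (a : ℝ) < c := by exact_mod_cast hac
  have hdisc : ((c : ℝ) - a) ^ 2 ≤ 4 * ((a : ℝ) * c) := sq_sub_le_four_mul ha'.le hac'.le hratio
  rw [mul_assoc]
  -- the polynomial objects
  set gW : ℝ[X] := row a c (-α) κ γ with hgW
  set B : ℝ[X] := row a c 0 q₀ s₀ * ∏ i, row a c (p i) (q i) (s i) with hB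
  -- the real functions of the proof
  obtain ⟨P₀, hP₀⟩ : ∃ P₀ : ℝ → ℝ, ∀ t, P₀ t = q₀ * t ^ a + s₀ * t ^ c := ⟨_, fun _ => rfl⟩
  obtain ⟨N₀, hN₀⟩ : ∃ N₀ : ℝ → ℝ, ∀ t, N₀ t = (a : ℝ) * q₀ * t ^ a + (c : ℝ) * s₀ * t ^ c := ⟨_, fun _ => rfl⟩
  obtain ⟨M₀, hM₀⟩ : ∃ M₀ : ℝ → ℝ, ∀ t, M₀ t = (a : ℝ) ^ 2 * q₀ * t ^ a + (c : ℝ) ^ 2 * s₀ * t ^ c :=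
    ⟨_, fun _ => rfl⟩
  obtain ⟨P, hP⟩ : ∃ P : Fin k → ℝ → ℝ, ∀ i t, P i t = p i + q i * t ^ a + s i * t ^ c := ⟨_, fun _ _ => rfl⟩
  obtain ⟨N, hN⟩ : ∃ N : Fin k → ℝ → ℝ, ∀ i t, N i t = (a : ℝ) * q i * t ^ a + (c : ℝ) * s i * t ^ c :=
    ⟨_, fun _ _ => rfl⟩
  obtain ⟨M, hM⟩ : ∃ M : Fin k → ℝ → ℝ, ∀ i t, M i t = (a : ℝ) ^ 2 * q i * t ^ a + (c : ℝ) ^ 2 * s i * t ^ c :=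
    ⟨_, fun _ _ => rfl⟩
  obtain ⟨ψ₀, hψ₀⟩ : ∃ ψ₀ : ℝ → ℝ, ∀ t, ψ₀ t = N₀ t / P₀ t := ⟨_, fun _ => rfl⟩
  obtain ⟨ψ, hψ⟩ : ∃ ψ : Fin k → ℝ → ℝ, ∀ i t, ψ i t = N i t / P i t := ⟨_, fun _ _ => rfl⟩
  obtain ⟨ψB, hψB⟩ : ∃ ψB : ℝ → ℝ, ∀ t, ψB t = ψ₀ t + ∑ i, ψ i t := ⟨_, fun _ => rfl⟩
  obtain ⟨V, hV⟩ : ∃ V : ℝ → ℝ, ∀ t,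
      V t = (M₀ t / P₀ t - ψ₀ t ^ 2) + ∑ i, (M i t / P i t - ψ i t ^ 2) := ⟨_, fun _ => rfl⟩
  obtain ⟨g, hg⟩ : ∃ g : ℝ → ℝ, ∀ t, g t = -α + κ * t ^ a + γ * t ^ c := ⟨_, fun _ => rfl⟩
  obtain ⟨G, hG⟩ : ∃ G : ℝ → ℝ, ∀ t, G t = (a : ℝ) * κ * t ^ a + (c : ℝ) * γ * t ^ c := ⟨_, fun _ => rfl⟩
  obtain ⟨G₂, hG₂⟩ : ∃ G₂ : ℝ → ℝ, ∀ t, G₂ t = (a : ℝ) ^ 2 * κ * t ^ a + (c : ℝ) ^ 2 * γ * t ^ c :=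
    ⟨_, fun _ => rfl⟩
  obtain ⟨Bf, hBf⟩ : ∃ Bf : ℝ → ℝ, ∀ t, Bf t = P₀ t * ∏ i, P i t := ⟨_, fun _ => rfl⟩
  obtain ⟨J, hJ⟩ : ∃ J : ℝ → ℝ, ∀ t, J t = V t / ψB t - ψB t - G₂ t / G t := ⟨_, fun _ => rfl⟩
  obtain ⟨F, hF⟩ : ∃ F : ℝ → ℝ, ∀ t, F t = (1 + g t * ψB t / G t) / Bf t := ⟨_, fun _ => rfl⟩
  -- elementary facts
  have hP₀pos : ∀ t, 0 < t → 0 < P₀ t := fun t ht => by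
    rw [hP₀]
    rcases hq₀.eq_or_lt with h0 | h0
    · have : 0 < s₀ := by linarith
      rw [← h0, zero_mul, zero_add]; positivity
    · exact add_pos_of_pos_of_nonneg (mul_pos h0 (pow_pos ht a)) (by positivity)
  have hPpos : ∀ i t, 0 < t → 0 < P i t := fun i t ht => by
    rw [hP]
    have := (h i).1
    have : 0 ≤ q i * t ^ a := mul_nonneg (h i).2.1 (pow_pos ht a).le
    have : 0 ≤ s i * t ^ c := mul_nonneg (h i).2.2 (pow_pos ht c).le
    linarith
  have hP₀row : ∀ t, (row a c 0 q₀ s₀).eval t = P₀ t := fun t => by simp [eval_row, hP₀]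
  have hProw : ∀ i t, (row a c (p i) (q i) (s i)).eval t = P i t := fun i t => by simp [eval_row, hP]
  have hgrow : ∀ t, gW.eval t = g t := fun t => by simp [hgW, eval_row, hg]
  have hBev : ∀ t, B.eval t = Bf t := fun t => by
    rw [hB, eval_mul, eval_prod, hBf, hP₀row]; exact congrArg _ (prod_congr rfl fun i _ => hProw i t)
  have hBpos : ∀ t, 0 < t → 0 < Bf t := fun t ht => by
    rw [hBf]; exact mul_pos (hP₀pos t ht) (prod_pos fun i _ => hPpos i t ht)
  have hGpos : ∀ t, 0 < t → 0 < G t := fun t ht => by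
    rw [hG]; exact add_pos_of_nonneg_of_pos (by positivity) (by positivity)
  have hψ₀ge : ∀ t, 0 < t → (a : ℝ) ≤ ψ₀ t := fun t ht => by
    rw [hψ₀, le_div_iff₀ (hP₀pos t ht), hN₀, hP₀]
    nlinarith [mul_nonneg hs₀ (pow_pos ht c).le]
  have hψnn : ∀ i t, 0 < t → 0 ≤ ψ i t := fun i t ht => by
    rw [hψ, hN]
    exact div_nonneg (add_nonneg (mul_nonneg (mul_nonneg ha'.le (h i).2.1) (pow_pos ht a).le)
      (mul_nonneg (mul_nonneg hc'.le (h i).2.2) (pow_pos ht c).le)) (hPpos i t ht).le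
  have hψBpos : ∀ t, 0 < t → 0 < ψB t := fun t ht => by
    rw [hψB]
    exact add_pos_of_pos_of_nonneg (ha'.trans_le (hψ₀ge t ht)) (sum_nonneg fun i _ => hψnn i t ht)
  have hgmono : ∀ t t', 0 ≤ t → t ≤ t' → g t ≤ g t' := fun t t' ht htt => by
    rw [← hgrow, ← hgrow, hgW]; exact eval_row_mono _ hκ hγ.le ht htt
  -- `t·B′(t) = B(t)·ψ_B(t)` and `t·g′(t) = G(t)`
  have hBder : ∀ t, 0 < t → (derivative B).eval t = Bf t * (ψB t / t) := by
    intro t ht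
    have hprodder : (derivative (∏ i, row a c (p i) (q i) (s i))).eval t =
        (∏ i, row a c (p i) (q i) (s i)).eval t *
          ∑ i, (derivative (row a c (p i) (q i) (s i))).eval t / (row a c (p i) (q i) (s i)).eval t := by
      have := eval_derivative_prod_rows k a c (fun i => (p i, q i, s i)) (x := t)
        (fun j => by simpa [hProw] using (hPpos j t ht).ne')
      simpa using this
    have hsum : t * ∑ i, (derivative (row a c (p i) (q i) (s i))).eval t / (row a c (p i) (q i) (s i)).eval t
        = ∑ i, ψ i t := by
      rw [mul_sum]
      refine sum_congr rfl fun i _ => ?_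
      rw [mul_div_assoc', mul_eval_derivative_row, hProw, hψ, hN]
    have hprodev : (∏ i, row a c (p i) (q i) (s i)).eval t = ∏ i, P i t := by
      rw [eval_prod]; exact prod_congr rfl fun i _ => hProw i t
    have h0' : t * (derivative (row a c 0 q₀ s₀)).eval t = N₀ t := by rw [mul_eval_derivative_row, hN₀]
    have hP0 : P₀ t ≠ 0 := (hP₀pos t ht).ne'
    have e1 : (derivative B).eval t = (derivative (row a c 0 q₀ s₀)).eval t * ∏ i, P i t + P₀ t * ((∏ i, P i t) *
          ∑ i, (derivative (row a c (p i) (q i) (s i))).eval t / (row a c (p i) (q i) (s i)).eval t) := by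
      rw [hB, derivative_mul, eval_add,
        show (derivative (row a c 0 q₀ s₀) * ∏ i, row a c (p i) (q i) (s i)).eval t =
          (derivative (row a c 0 q₀ s₀)).eval t * (∏ i, row a c (p i) (q i) (s i)).eval t from eval_mul,
        show (row a c 0 q₀ s₀ * derivative (∏ i, row a c (p i) (q i) (s i))).eval t =
          (row a c 0 q₀ s₀).eval t * (derivative (∏ i, row a c (p i) (q i) (s i))).eval t from eval_mul,
        hprodder, hP₀row, hprodev]
    rw [mul_div_assoc', eq_div_iff ht.ne', e1, hBf, hψB, hψ₀]
    calc ((derivative (row a c 0 q₀ s₀)).eval t * ∏ i, P i t + P₀ t * ((∏ i, P i t) *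
          ∑ i, (derivative (row a c (p i) (q i) (s i))).eval t / (row a c (p i) (q i) (s i)).eval t)) * t
        = (t * (derivative (row a c 0 q₀ s₀)).eval t) * ∏ i, P i t + P₀ t * (∏ i, P i t) *
          (t * ∑ i, (derivative (row a c (p i) (q i) (s i))).eval t / (row a c (p i) (q i) (s i)).eval t) := by
          ring
      _ = P₀ t * (∏ i, P i t) * (N₀ t / P₀ t + ∑ i, ψ i t) := by rw [h0', hsum]; field_simp
  have hgWder : ∀ t, t * (derivative gW).eval t = G t := fun t => by
    rw [hgW, mul_eval_derivative_row, hG]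
  -- the link `t·Φ′(t) = B(t)·(G(t) + g(t)·ψ_B(t))`
  have hlink : ∀ t, 0 < t →
      t * (derivative (gW * B)).eval t = Bf t * (G t + g t * ψB t) := by
    intro t ht
    rw [derivative_mul, eval_add,
      show (derivative gW * B).eval t = (derivative gW).eval t * B.eval t from eval_mul,
      show (gW * derivative B).eval t = gW.eval t * (derivative B).eval t from eval_mul, hBder t ht, hgrow, hBev]
    calc t * ((derivative gW).eval t * Bf t + g t * (Bf t * (ψB t / t)))
        = (t * (derivative gW).eval t) * Bf t + g t * Bf t * ψB t * (t / t) := by ring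
      _ = Bf t * (G t + g t * ψB t) := by rw [hgWder, div_self ht.ne']; ring
  -- at a positive critical point: `G + g·ψ_B = 0`, hence `g < 0` and `F = 0`
  have hcrit : ∀ t, 0 < t → (derivative (gW * B)).eval t = 0 → g t < 0 ∧ F t = 0 := by
    intro t ht hD
    have h0 : G t + g t * ψB t = 0 := by
      have := hlink t ht
      rw [hD, mul_zero] at this
      rcases mul_eq_zero.1 this.symm with h1 | h1
      · exact absurd h1 (hBpos t ht).ne'
      · exact h1
    have hgt : g t < 0 := by
      rcases lt_or_ge (g t) 0 with h1 | h1
      · exact h1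
      · nlinarith [mul_nonneg h1 (hψBpos t ht).le, hGpos t ht]
    refine ⟨hgt, ?_⟩
    have e : g t * ψB t = -G t := by linarith
    rw [hF, e, neg_div, div_self (hGpos t ht).ne', add_neg_cancel, zero_div]
  -- the derivative of `F` on `(0,∞)`
  have hFd : ∀ t, 0 < t → HasDerivAt F (g t * ψB t / (t * Bf t * G t) * J t) t := by
    intro t ht
    have ht0 : t ≠ 0 := ht.ne'
    have hpowa : (a : ℝ) * t ^ (a - 1) = (a : ℝ) * t ^ a / t := by
      rw [eq_div_iff ht0, mul_assoc, ← pow_succ, Nat.sub_add_cancel (show 1 ≤ a from ha)]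
    have hpowc : (c : ℝ) * t ^ (c - 1) = (c : ℝ) * t ^ c / t := by
      rw [eq_div_iff ht0, mul_assoc, ← pow_succ, Nat.sub_add_cancel (show 1 ≤ c from hc)]
    -- generic two-term rows `u + v t^a + w t^c`
    have hrow : ∀ u v w : ℝ, HasDerivAt (fun x => u + v * x ^ a + w * x ^ c)
        (((a : ℝ) * v * t ^ a + (c : ℝ) * w * t ^ c) / t) t := by
      intro u v w
      refine ((((hasDerivAt_pow a t).const_mul v).const_add u).fun_add
        ((hasDerivAt_pow c t).const_mul w)).congr_deriv ?_
      have e1 : v * ((a : ℝ) * t ^ (a - 1)) = (a : ℝ) * v * t ^ a / t := by rw [hpowa]; ring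
      have e2 : w * ((c : ℝ) * t ^ (c - 1)) = (c : ℝ) * w * t ^ c / t := by rw [hpowc]; ring
      rw [e1, e2]; ring
    have hrow0 : ∀ v w : ℝ, HasDerivAt (fun x => v * x ^ a + w * x ^ c)
        (((a : ℝ) * v * t ^ a + (c : ℝ) * w * t ^ c) / t) t := by
      intro v w
      refine (((hasDerivAt_pow a t).const_mul v).fun_add ((hasDerivAt_pow c t).const_mul w)).congr_deriv ?_
      have e1 : v * ((a : ℝ) * t ^ (a - 1)) = (a : ℝ) * v * t ^ a / t := by rw [hpowa]; ring
      have e2 : w * ((c : ℝ) * t ^ (c - 1)) = (c : ℝ) * w * t ^ c / t := by rw [hpowc]; ring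
      rw [e1, e2]; ring
    -- the constant-free row
    have hP₀d : HasDerivAt P₀ (N₀ t / t) t := by
      refine ((hrow0 q₀ s₀).congr_of_eventuallyEq (Filter.Eventually.of_forall hP₀)).congr_deriv ?_
      rw [hN₀]
    have hN₀d : HasDerivAt N₀ (M₀ t / t) t := by
      refine ((hrow0 ((a : ℝ) * q₀) ((c : ℝ) * s₀)).congr_of_eventuallyEq
        (Filter.Eventually.of_forall hN₀)).congr_deriv ?_
      rw [hM₀]; ring
    have hψ₀d : HasDerivAt ψ₀ ((M₀ t / P₀ t - ψ₀ t ^ 2) / t) t := by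
      have h1 := hN₀d.fun_div hP₀d (hP₀pos t ht).ne'
      refine (h1.congr_of_eventuallyEq (Filter.Eventually.of_forall hψ₀)).congr_deriv ?_
      have hP0 : P₀ t ≠ 0 := (hP₀pos t ht).ne'
      rw [hψ₀]
      field_simp
    -- the other rows
    have hPd : ∀ i, HasDerivAt (P i) (N i t / t) t := by
      intro i
      refine ((hrow (p i) (q i) (s i)).congr_of_eventuallyEq (Filter.Eventually.of_forall (hP i))).congr_deriv ?_
      rw [hN]
    have hNd : ∀ i, HasDerivAt (N i) (M i t / t) t := by
      intro i
      refine ((hrow0 ((a : ℝ) * q i) ((c : ℝ) * s i)).congr_of_eventuallyEq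
        (Filter.Eventually.of_forall (hN i))).congr_deriv ?_
      rw [hM]; ring
    have hψd : ∀ i, HasDerivAt (ψ i) ((M i t / P i t - ψ i t ^ 2) / t) t := by
      intro i
      have h1 := (hNd i).fun_div (hPd i) (hPpos i t ht).ne'
      refine (h1.congr_of_eventuallyEq (Filter.Eventually.of_forall (hψ i))).congr_deriv ?_
      have hP0 : P i t ≠ 0 := (hPpos i t ht).ne'
      rw [hψ]
      field_simp
    have hψBd : HasDerivAt ψB (V t / t) t := by
      have h1 : HasDerivAt (fun x => ψ₀ x + ∑ i, ψ i x)
          ((M₀ t / P₀ t - ψ₀ t ^ 2) / t + ∑ i, (M i t / P i t - ψ i t ^ 2) / t) t :=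
        hψ₀d.fun_add (HasDerivAt.fun_sum (u := univ) (fun i _ => hψd i))
      refine (h1.congr_of_eventuallyEq (Filter.Eventually.of_forall hψB)).congr_deriv ?_
      rw [hV, add_div, sum_div]
    have hgd : HasDerivAt g (G t / t) t := by
      refine ((hrow (-α) κ γ).congr_of_eventuallyEq (Filter.Eventually.of_forall hg)).congr_deriv ?_
      rw [hG]
    have hGd : HasDerivAt G (G₂ t / t) t := by
      refine ((hrow0 ((a : ℝ) * κ) ((c : ℝ) * γ)).congr_of_eventuallyEq
        (Filter.Eventually.of_forall hG)).congr_deriv ?_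
      rw [hG₂]; ring
    have hBfd : HasDerivAt Bf (Bf t * (ψB t / t)) t :=
      ((B.hasDerivAt t).congr_of_eventuallyEq (Filter.Eventually.of_forall fun x => (hBev x).symm)).congr_deriv
        (hBder t ht)
    -- assemble
    have h1 := (hgd.fun_mul hψBd).fun_div hGd (hGpos t ht).ne'
    have h2 := (h1.const_add 1).fun_div hBfd (hBpos t ht).ne'
    refine (h2.congr_of_eventuallyEq (Filter.Eventually.of_forall hF)).congr_deriv ?_
    have hB0 : Bf t ≠ 0 := (hBpos t ht).ne'
    have hG0 : G t ≠ 0 := (hGpos t ht).ne'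
    have hS0 : ψB t ≠ 0 := (hψBpos t ht).ne'
    rw [hJ]
    field_simp
    ring
  -- `J < 0` on `(0,∞)` (Bhatia–Davis row by row, then the ratio window)
  have hJneg : ∀ t, 0 < t → J t < 0 := by
    intro t ht
    -- row bounds
    have hrowi : ∀ i, M i t / P i t - ψ i t ^ 2 ≤ (c : ℝ) * ψ i t - ψ i t ^ 2 := by
      intro i
      have hP0 : 0 < P i t := hPpos i t ht
      rw [hψ, mul_div_assoc', sub_le_sub_iff_right, div_le_div_iff_of_pos_right hP0, hM, hN]
      have : (a : ℝ) ^ 2 * q i * t ^ a ≤ (c : ℝ) * ((a : ℝ) * q i * t ^ a) := by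
        have h1 : 0 ≤ (a : ℝ) * q i * t ^ a := mul_nonneg (mul_nonneg ha'.le (h i).2.1) (pow_pos ht a).le
        nlinarith
      nlinarith
    have hrow0 : M₀ t / P₀ t - ψ₀ t ^ 2 = ((a : ℝ) + c) * ψ₀ t - (a : ℝ) * c - ψ₀ t ^ 2 := by
      have hP0 : P₀ t ≠ 0 := (hP₀pos t ht).ne'
      rw [hψ₀, hM₀, hN₀]
      field_simp
      rw [hP₀]
      ring
    have hVle : V t ≤ (c : ℝ) * ψB t - (a : ℝ) * c := by
      rw [hV, hrow0, hψB]
      have h1 : ∑ i, (M i t / P i t - ψ i t ^ 2) ≤ ∑ i, (c : ℝ) * ψ i t := by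
        refine sum_le_sum fun i _ => (hrowi i).trans ?_
        nlinarith [sq_nonneg (ψ i t)]
      have h2 := hψ₀ge t ht
      rw [← mul_sum] at h1
      nlinarith [mul_nonneg (ha'.le.trans h2) (sub_nonneg.2 h2)]
    have hAgt : (a : ℝ) < G₂ t / G t := by
      rw [lt_div_iff₀ (hGpos t ht), hG₂, hG]
      have : 0 < (c : ℝ) * γ * t ^ c * ((c : ℝ) - a) := by
        have := sub_pos.2 hac'
        positivity
      nlinarith [mul_nonneg (mul_nonneg ha'.le hκ) (pow_pos ht a).le]
    have hpos := hψBpos t ht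
    have hq : ((c : ℝ) - a) * ψB t - (a : ℝ) * c - ψB t ^ 2 ≤ 0 := by
      nlinarith [sq_nonneg (ψB t - ((c : ℝ) - a) / 2)]
    have hVd : V t / ψB t ≤ (c : ℝ) - (a : ℝ) * c / ψB t := by
      rw [div_le_iff₀ hpos, sub_mul, div_mul_cancel₀ _ hpos.ne']
      exact hVle
    have hkey : (c : ℝ) - (a : ℝ) * c / ψB t - ψB t - a ≤ 0 := by
      have e : (c : ℝ) - (a : ℝ) * c / ψB t - ψB t - a = (((c : ℝ) - a) * ψB t - (a : ℝ) * c - ψB t ^ 2) / ψB t := by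
        field_simp
        ring
      rw [e]
      exact div_nonpos_of_nonpos_of_nonneg hq hpos.le
    rw [hJ]
    linarith
  -- two positive critical points are impossible (Rolle)
  have hmain : ∀ u v, 0 < u → u < v → (derivative (gW * B)).eval u = 0 →
      (derivative (gW * B)).eval v = 0 → False := by
    intro u v hu huv hDu hDv
    obtain ⟨-, hFu⟩ := hcrit u hu hDu
    obtain ⟨hgv, hFv⟩ := hcrit v (hu.trans huv) hDv
    have hcont : ContinuousOn F (Icc u v) := fun w hw =>
      (hFd w (hu.trans_le hw.1)).continuousAt.continuousWithinAt
    obtain ⟨ξ, hξ, hξ0⟩ := exists_hasDerivAt_eq_zero huv hcont (hFu.trans hFv.symm)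
      (fun w hw => hFd w (hu.trans hw.1))
    have hξpos : 0 < ξ := hu.trans hξ.1
    have hgξ : g ξ < 0 := (hgmono ξ v hξpos.le hξ.2.le).trans_lt hgv
    have hne : g ξ * ψB ξ / (ξ * Bf ξ * G ξ) ≠ 0 := by
      apply div_ne_zero
      · exact mul_ne_zero hgξ.ne (hψBpos ξ hξpos).ne'
      · exact mul_ne_zero (mul_ne_zero hξpos.ne' (hBpos ξ hξpos).ne') (hGpos ξ hξpos).ne'
    rcases mul_eq_zero.1 hξ0 with h1 | h1
    · exact hne h1
    · exact (hJneg ξ hξpos).ne h1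
  -- count
  rw [posCrit]
  by_contra hcard
  rw [not_le] at hcard
  obtain ⟨x, hx, y, hy, hxy⟩ := Finset.one_lt_card.1 hcard
  simp only [Finset.mem_filter, Multiset.mem_toFinset, mem_roots', IsRoot.def] at hx hy
  obtain ⟨⟨-, hDx⟩, hx0⟩ := hx
  obtain ⟨⟨-, hDy⟩, hy0⟩ := hy
  rcases lt_or_gt_of_ne hxy with hxy | hxy
  · exact hmain x y hx0 hxy hDx hDy
  · exact hmain y x hy0 hxy hDy hDx

end ZeroChange

end Summit.ValiantsHypothesis.ValiantsHypothesis.Theorems.LacunarySymmetroidMatrixDescartes
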